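import Literature.NumberTheory.Automorphic.HermitianFormAnisotropicPlacesFinite
import Literature.NumberTheory.Automorphic.AnisotropicUnitaryGroupCompactOfPlace
import Literature.NumberTheory.Automorphic.AdicCompletionLocalField
import Literature.NumberTheory.Automorphic.Liu2021.RemD5CompanionParity
import Mathlib.RingTheory.Trace.Basic
import HarnessLib

/-!
# `U(Φ₂)(F_v) = U(1,1)(F_v)` is NOT compact, so at an ANISOTROPIC place NO local identification `U(H)(L⁺_v) ≃ₜ* U(Φ₂)(L⁺_v)` exists:
# in rank 2 the exceptional set `S ⊇ T` of the quasi-split comparison letter is NECESSARY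
(Rogawski (1990), §3.8 p. 30, §14.2 p. 232; Platonov–Rapinchuk (1994), §3.1 Thm. 3.1; Weil (1967), Ch. I §2)

Topic `NumberTheory/Automorphic`; namespace `Literature.NumberTheory.Automorphic.UnitaryGroup`.  THEOREMS ONLY (no definition, no instance, no
named fact, no notation, no `sorry`).  NEGATIVE companion of ★ `LocalUnitaryGroupSimilitudeLevelRankTwo` ∕ ★ `HermitianFormAnisotropicPlacesFinite`
(which supply `ψ_v : U(H)(L⁺_v) ≃ₜ* U(Φ₂)(L⁺_v)` at every place OUTSIDE the finite anisotropic set `T`): INSIDE `T` no such `ψ_v` exists, because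
`U(H)(L⁺_v)` is compact there (★ `compactSpace_cmDatum_local_of_not_isIsotropic`, [PlatonovRapinchuk1994, §3.1 Thm. 3.1]) while `U(Φ₂)(F_v)` contains the
closed non-compact unipotent line `{u(b) = (1 b; 0 1) : b + b̄ = 0} ≅ F_v`.  Consequently the rank-3 shape of ★ `exists_psi_forall_levelMatching` ∕ ★
`GlobalTransferAway` — ONE TOTAL family `ψ : ∀ v, U(H)(L⁺_v) ≃ₜ* U(Φ_N)(L⁺_v)` — has NO rank-2 instance as soon as `T ≠ ∅` (which is forced when
`[L⁺:ℚ]` is even, ★ `Liu2021.RemD5CompanionParity.even_ncard_not_isIsotropic_iff`): the `N = 2` edition of the quasi-split comparison letter T1g(N, H)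
must carry its local identifications RELATIVISED to `v ∉ S`, `S ⊇ T` (director D1 s465; F0P3a SPEC-ed1.19c §7).

* §1 (quadratic `E/F`, `c ≠ 1`, `δ̄ = −δ ≠ 0`, every finite `v` of `F`) **`not_compactSpace_local_antidiagTwo`**: `¬ CompactSpace (U(Φ₂)(F_v))` — for
  `a ∈ F_v` the unipotent `u(ι_v(a) δ)` lies in `U(Φ₂)(F_v)`, and the CONTINUOUS map `g ↦ ½ Tr_{E_v/F_v}(δ⁻¹ · g₀₁)` sends it to `a`, so a compact
  `U(Φ₂)(F_v)` would surject continuously onto the non-compact `F_v` (the tree's `not_compactSpace_of_isNonarchimedeanLocalField`, here a private copy §0, ★ `AdicCompletionLocalField` instances);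
  `isEmpty_continuousMulEquiv_local_antidiagTwo_of_compactSpace` — hence no `U(J)(F_v) ≃ₜ* U(Φ₂)(F_v)` from a compact `U(J)(F_v)`.
* §2 (CM packaging, `F = L⁺`, `E = L`) **`isEmpty_cmDatum_local_equiv_antidiagTwo_of_not_isIsotropic`**: for `H ∈ M₂(L)` hermitian, `det H ≠ 0`, at a place
  `v ∈ T` (the local standing plane anisotropic, [Liu2021, App. D §D.1]) the type `(cmDatum L 2 H).Local v ≃ₜ* (cmDatum L 2 Φ₂).Local v` is EMPTY
  (witness-free: an anisotropic place is non-split by ★ `exists_isotropic_localGram_of_smul_ne`); **`isEmpty_forall_cmDatum_local_equiv_antidiagTwo`**: if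
  `T ≠ ∅` there is no total family `∀ v, …`; `…_of_even_finrank` — for the diagonal planes of the cell's P5 letters with `[L⁺:ℚ]` even.

HONEST LABEL: HC_CM is proved only modulo the printed citations until rung 0 closes; this file is unconditional, proves no cell binder, and refutes
no registered statement — it records why the rank-2 letter's `S ⊇ T` cannot be emptied.

## References
* [Rogawski1990] J. Rogawski, Ann. of Math. Stud. 123 (1990), §3.8 p. 30 (`U(2)` inner forms: `H′_ξ(F_v)` compact iff `ξ ∉ NE_v^×`), §14.2 p. 232.
* [PlatonovRapinchuk1994] V. Platonov, A. Rapinchuk, *Algebraic Groups and Number Theory* (1994), §3.1 Thm. 3.1 (anisotropic ⇔ compact).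
* [WeilBNT1967] A. Weil, *Basic Number Theory* (1967), Ch. I §2 (local fields are not compact).
* [Liu2021] Y. Liu, Camb. J. Math. 9 (2021), App. D Lem. D.1 (4).
-/

set_option autoImplicit false

noncomputable section

open NumberField IsDedekindDomain
open scoped Matrix MatrixGroups ComplexOrder

namespace Literature.NumberTheory.Automorphic

namespace UnitaryGroup

/-! ## §0 A non-archimedean local field is not compact (local copy) -/

section LocalField

open Set ValuativeRel

variable {K : Type*} [Field K] [ValuativeRel K] [TopologicalSpace K] [IsNonarchimedeanLocalField K]

/-- A non-archimedean local field is not compact: the balls `{v < t^k}` (`t > 1`) form an increasing open cover with no finite subcover,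
the valuation being surjective onto the value group (local copy of the tree's `not_compactSpace_of_isNonarchimedeanLocalField` of
`TateLocalFactorsCounterexample`, kept here to avoid the Tate-thesis imports). [folklore] -/
private theorem not_compactSpace_of_isNonarchimedeanLocalField' : ¬ CompactSpace K := by
  intro hF
  obtain ⟨γ, hγ0, hγ1⟩ := ValuativeRel.IsNontrivial.exists_lt_one (R := K)
  have ht : 1 < γ⁻¹ := (one_lt_inv₀ hγ0).2 hγ1
  have ht0 : γ⁻¹ ≠ 0 := inv_ne_zero hγ0.ne'
  set U : ℕ → Set K := fun k => {x | valuation K x < γ⁻¹ ^ k} with hU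
  have hUo : ∀ k, IsOpen (U k) := fun k => by
    rw [isOpen_iff_mem_nhds]
    intro x hx
    rw [IsValuativeTopology.mem_nhds_iff']
    refine ⟨Units.mk0 (γ⁻¹ ^ k) (pow_ne_zero _ ht0), fun z hz => ?_⟩
    have hz' : valuation K (z - x) < γ⁻¹ ^ k := by simpa using hz
    have hx' : valuation K x < γ⁻¹ ^ k := hx
    show valuation K z < γ⁻¹ ^ k
    calc valuation K z = valuation K (z - x + x) := by rw [sub_add_cancel]
      _ ≤ max (valuation K (z - x)) (valuation K x) := Valuation.map_add _ _ _
      _ < γ⁻¹ ^ k := max_lt hz' hx'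
  have hcov : (univ : Set K) ⊆ ⋃ k, U k := fun x _ => by
    obtain ⟨k, hk⟩ := MulArchimedean.arch (valuation K x) ht
    exact mem_iUnion.2 ⟨k + 1, lt_of_le_of_lt hk (pow_lt_pow_right₀ ht (Nat.lt_succ_self k))⟩
  obtain ⟨T, hT⟩ := (@isCompact_univ K _ hF).elim_finite_subcover U hUo hcov
  have hmono : ∀ {k l : ℕ}, k ≤ l → U k ⊆ U l := fun hkl x hx =>
    lt_of_lt_of_le hx (pow_le_pow_right₀ ht.le hkl)
  obtain ⟨g, hg⟩ := ValuativeRel.valuation_surjective (γ⁻¹ ^ (T.sup id) : ValueGroupWithZero K)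
  have hmem := hT (mem_univ g)
  simp only [mem_iUnion] at hmem
  obtain ⟨k, hk, hgk⟩ := hmem
  have hlt : valuation K g < γ⁻¹ ^ (T.sup id) := hmono (Finset.le_sup (f := id) hk) hgk
  rw [hg] at hlt
  exact lt_irrefl _ hlt

end LocalField

/-! ## §1 `U(Φ₂)(F_v)` is not compact -/

section Generic

variable {F E : Type} [Field F] [NumberField F] [Field E] [NumberField E] [Algebra F E]
  [Algebra.IsQuadraticExtension F E] (c : E ≃ₐ[F] E)

/-- **`U(Φ₂)(F_v) = U(1,1)(F_v)` is not compact** ([Rogawski1990, §3.8 p. 30]: the quasi-split unitary group in two variables; [WeilBNT1967, Ch. I §2]):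
for a trace-zero `δ ≠ 0` (so `c ≠ 1`) and every finite place `v` of `F`, the unipotents `u(b) = (1 b; 0 1)` with `b + b̄ = 0` — e.g. `b = ι_v(a) · δ`,
`a ∈ F_v` — lie in `U(Φ₂)(F_v)`, and the continuous `F_v`-linear functional `x ↦ Tr_{E_v/F_v}(δ⁻¹ x)` of the entry `g₀₁` takes the value `2a` on
`u(ι_v(a) δ)`; a compact `U(Φ₂)(F_v)` would thus map continuously ONTO `F_v`, which is not compact (§0).
[cite: Rogawski1990, §3.8 p. 30] [cite: WeilBNT1967, Ch. I §2] -/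
theorem not_compactSpace_local_antidiagTwo {δ : E} (hcδ : c δ = -δ) (hδ : δ ≠ 0) (v : HeightOneSpectrum (𝓞 F)) :
    ¬ CompactSpace («local» E c 2 (Matrix.of fun i j : Fin 2 => if i.val + j.val + 1 = 2 then (1 : E) else 0) v) := by
  classical
  intro hK
  haveI : CharZero (v.adicCompletion F) := charZero_of_injective_algebraMap (algebraMap F _).injective
  haveI : IsModuleTopology (v.adicCompletion F) (LocalRing E v) := Liu2021.LemD1OfPlace.isModuleTopology_localRing E v
  set Φ : Matrix (Fin 2) (Fin 2) E := Matrix.of fun i j : Fin 2 => if i.val + j.val + 1 = 2 then (1 : E) else 0 with hΦ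
  -- the local Gram matrix is `antidiag(1,1)`
  have hJ : (adelicForm E 2 Φ).map (adeleToLocal E v) = !![(0 : LocalRing E v), 1; 1, 0] := by
    rw [Liu2021.LemD1OfPlace.localGram_eq E v 2 Φ]
    ext i j
    fin_cases i <;> fin_cases j <;> simp [hΦ]
  -- the unipotent `u(b)` for `b̄ = -b` lies in `U(Φ₂)(F_v)`
  have hmem : ∀ b : LocalRing E v, conjLocal E c v b = -b →
      (⟨!![1, b; 0, 1], !![1, -b; 0, 1], by simp [Matrix.one_fin_two],
        by simp [Matrix.one_fin_two]⟩ : GL (Fin 2) (LocalRing E v)) ∈ «local» E c 2 Φ v := by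
    intro b hb
    show _ ∈ unitaryGroupOfForm _ _
    rw [mem_unitaryGroupOfForm_iff, hJ]
    ext i j
    fin_cases i <;> fin_cases j <;> simp [Matrix.mul_apply, Fin.sum_univ_two, hb]
  -- the continuous functional `g ↦ Tr(δ⁻¹ · g₀₁)`
  let δv : LocalRing E v := algebraMap E (LocalRing E v) δ
  let ℓ : LocalRing E v →ₗ[v.adicCompletion F] v.adicCompletion F :=
    (Algebra.trace (v.adicCompletion F) (LocalRing E v)) ∘ₗ
      (LinearMap.mulLeft (v.adicCompletion F) (algebraMap E (LocalRing E v) δ⁻¹))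
  have hℓ : Continuous ℓ := IsModuleTopology.continuous_of_linearMap ℓ
  let e : («local» E c 2 Φ v) → v.adicCompletion F := fun g =>
    ℓ ((((g : GL (Fin 2) (LocalRing E v)) : Matrix (Fin 2) (Fin 2) (LocalRing E v))) 0 1)
  have he : Continuous e := by
    refine hℓ.comp ?_
    exact (Units.continuous_val.comp continuous_subtype_val).matrix_elem 0 1
  -- `e (u(ι a δ)) = 2 a`
  have hval : ∀ a : v.adicCompletion F, ∃ g : «local» E c 2 Φ v, e g = (2 : ℕ) • a := by
    intro a
    have hb : conjLocal E c v (algebraMap (v.adicCompletion F) (LocalRing E v) a * δv) =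
        -(algebraMap (v.adicCompletion F) (LocalRing E v) a * δv) := by
      rw [map_mul, algebraMap_localRing_eq, conjLocal_toLocalRing, conjLocal_algebraMap, hcδ, map_neg, mul_neg]
    refine ⟨⟨_, hmem _ hb⟩, ?_⟩
    show ℓ (algebraMap (v.adicCompletion F) (LocalRing E v) a * δv) = (2 : ℕ) • a
    have hδδ : algebraMap E (LocalRing E v) δ⁻¹ * (algebraMap (v.adicCompletion F) (LocalRing E v) a * δv) =
        algebraMap (v.adicCompletion F) (LocalRing E v) a := by
      rw [mul_left_comm, ← map_mul, inv_mul_cancel₀ hδ, map_one, mul_one]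
    simp only [ℓ, LinearMap.coe_comp, Function.comp_apply, LinearMap.mulLeft_apply, hδδ]
    rw [Algebra.trace_algebraMap, finrank_localRing E v]
  -- a compact `U(Φ₂)(F_v)` would surject continuously onto `F_v`
  have hsurj : Function.Surjective e := by
    intro t
    obtain ⟨g, hg⟩ := hval (t / 2)
    refine ⟨g, ?_⟩
    rw [hg, nsmul_eq_mul, Nat.cast_ofNat, mul_div_cancel₀ t (two_ne_zero)]
  have hKF : CompactSpace (v.adicCompletion F) := ⟨by rw [← hsurj.range_eq]; exact isCompact_range he⟩
  exact not_compactSpace_of_isNonarchimedeanLocalField' (K := v.adicCompletion F) hKF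

/-- **No isomorphism of topological groups from a COMPACT `U(J)(F_v)` onto `U(Φ₂)(F_v)`** (it would transport compactness).
[cite: PlatonovRapinchuk1994, §3.1 Thm. 3.1] [cite: Rogawski1990, §3.8 p. 30] -/
theorem isEmpty_continuousMulEquiv_local_antidiagTwo_of_compactSpace {δ : E} (hcδ : c δ = -δ) (hδ : δ ≠ 0)
    (v : HeightOneSpectrum (𝓞 F)) (J : Matrix (Fin 2) (Fin 2) E) [CompactSpace («local» E c 2 J v)] :
    IsEmpty («local» E c 2 J v ≃ₜ* «local» E c 2 (Matrix.of fun i j : Fin 2 => if i.val + j.val + 1 = 2 then (1 : E) else 0) v) :=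
  ⟨fun ψ => not_compactSpace_local_antidiagTwo c hcδ hδ v ψ.toHomeomorph.compactSpace⟩

end Generic

/-! ## §2 CM packaging: no `ψ_v` at an anisotropic place, no total family `ψ` when `T ≠ ∅` -/

section CM

variable (L : Type) [Field L] [NumberField L] [IsCMField L]

/-- **At a place `v ∈ T` there is NO `U(H)(L⁺_v) ≃ₜ* U(Φ₂)(L⁺_v)`** (`H ∈ M₂(L)` hermitian, `det H ≠ 0`, the local standing plane at `v` ANISOTROPIC —
[Liu2021, App. D §D.1] `¬ LemD1.IsIsotropic`): `U(H)(L⁺_v)` is compact (★ `compactSpace_cmDatum_local_of_not_isIsotropic`; the non-split witness it asks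
for exists because a split place is always isotropic, ★ `exists_isotropic_localGram_of_smul_ne`) and `U(Φ₂)(L⁺_v)` is not (§1).  The rank-2 letter's
exceptional set `S ⊇ T` cannot be emptied. [cite: PlatonovRapinchuk1994, §3.1 Thm. 3.1] [cite: Rogawski1990, §14.2 p. 232] [cite: Liu2021, App. D Lem. D.1 (4)] -/
theorem isEmpty_cmDatum_local_equiv_antidiagTwo_of_not_isIsotropic (H : Matrix (Fin 2) (Fin 2) L)
    (hH : (H.map (cmConjRingHom L))ᵀ = H) (hHd : H.det ≠ 0) {δ : L} (hcδ : IsCMField.complexConj L δ = -δ) (hδ : δ ≠ 0)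
    (v : HeightOneSpectrum (𝓞 ↥(maximalRealSubfield L)))
    (hv : ¬ Liu2021.LemD1.IsIsotropic (Liu2021.LemD1OfPlace.standingData L v (IsCMField.complexConj L) 2 H hcδ hδ le_rfl
      ((map_cmConjRingHom_eq_map_complexConj L H) ▸ hH) hHd)) :
    IsEmpty ((cmDatum L 2 H).Local v ≃ₜ*
      (cmDatum L 2 (Matrix.of fun i j : Fin 2 => if i.val + j.val + 1 = 2 then (1 : L) else 0)).Local v) := by
  obtain ⟨w⟩ : Nonempty (PlacesOver L v) := inferInstance
  -- an anisotropic place is non-split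
  have hw : IsCMField.complexConj L • w.1 = w.1 := by
    by_contra hne
    exact hv ((isIsotropic_standingData_iff_localGram L (IsCMField.complexConj L) H v hcδ hδ le_rfl
      ((map_cmConjRingHom_eq_map_complexConj L H) ▸ hH) hHd).2
      (exists_isotropic_localGram_of_smul_ne (IsCMField.complexConj L) w hne (by norm_num) _))
  haveI : CompactSpace («local» L (IsCMField.complexConj L) 2 H v) :=
    compactSpace_cmDatum_local_of_not_isIsotropic L 2 H v w hw hcδ hδ le_rfl ((map_cmConjRingHom_eq_map_complexConj L H) ▸ hH) hHd hv
  exact isEmpty_continuousMulEquiv_local_antidiagTwo_of_compactSpace (IsCMField.complexConj L) hcδ hδ v H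

/-- **No TOTAL family `ψ : ∀ v, U(H)(L⁺_v) ≃ₜ* U(Φ₂)(L⁺_v)` once `T ≠ ∅`** — the rank-3 shape of ★ `exists_psi_forall_levelMatching` ∕ ★ `GlobalTransferAway` has
no rank-2 instance for such `H`; the `N = 2` letter must relativise `ψ` to `v ∉ S ⊇ T` (★ `exists_finset_rankTwo_levelMatching`).
[cite: Rogawski1990, §14.2 p. 232] [cite: PlatonovRapinchuk1994, §3.1 Thm. 3.1] -/
theorem isEmpty_forall_cmDatum_local_equiv_antidiagTwo (H : Matrix (Fin 2) (Fin 2) L)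
    (hH : (H.map (cmConjRingHom L))ᵀ = H) (hHd : H.det ≠ 0) {δ : L} (hcδ : IsCMField.complexConj L δ = -δ) (hδ : δ ≠ 0)
    (hT : ∃ v : HeightOneSpectrum (𝓞 ↥(maximalRealSubfield L)),
      ¬ Liu2021.LemD1.IsIsotropic (Liu2021.LemD1OfPlace.standingData L v (IsCMField.complexConj L) 2 H hcδ hδ le_rfl
        ((map_cmConjRingHom_eq_map_complexConj L H) ▸ hH) hHd)) :
    IsEmpty (∀ v : HeightOneSpectrum (𝓞 ↥(maximalRealSubfield L)), (cmDatum L 2 H).Local v ≃ₜ*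
      (cmDatum L 2 (Matrix.of fun i j : Fin 2 => if i.val + j.val + 1 = 2 then (1 : L) else 0)).Local v) := by
  obtain ⟨v, hv⟩ := hT
  haveI := isEmpty_cmDatum_local_equiv_antidiagTwo_of_not_isIsotropic L H hH hHd hcδ hδ v hv
  exact ⟨fun ψ => isEmptyElim (ψ v)⟩

/-- **For the diagonal planes of the cell's P5 letters over a CM field with `[L⁺:ℚ]` EVEN there is no total family `ψ`**: the number of anisotropic
finite places is then ODD (★ `Liu2021.RemD5CompanionParity.even_ncard_not_isIsotropic_iff`: it is even iff `[L⁺:ℚ]` is odd), so `T ≠ ∅`.  Binders as in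
that theorem (`H = diag(dJ₀, dJ₁)` of signature `(1,1)` at `ι₁` and definite elsewhere). [cite: Liu2021, App. D §D.3 and Lem. D.1 (4)]
[cite: Rogawski1990, §14.2 p. 232] -/
theorem isEmpty_forall_cmDatum_local_equiv_antidiagTwo_of_even_finrank (ι₁ : L →+* ℂ) (dJ : Fin 2 → L)
    (hdJ : ∀ i, IsCMField.complexConj L (dJ i) = dJ i) (hdJ0 : ∀ i, dJ i ≠ 0)
    (hsig : (∃ Tstar : GL (Fin 2) ℂ,
        formCongr (starRingEnd ℂ) Tstar ((Matrix.diagonal dJ).map ι₁) = Matrix.diagonal ![(1 : ℂ), -1]) ∧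
      ∀ τ' : L →+* ℂ, InfinitePlace.mk τ' ≠ InfinitePlace.mk ι₁ → ((Matrix.diagonal dJ).map τ').PosDef)
    {δ : L} (hcδ : IsCMField.complexConj L δ = -δ) (hδ : δ ≠ 0)
    (hJh : ((Matrix.diagonal dJ).map (IsCMField.complexConj L))ᵀ = Matrix.diagonal dJ) (hJdet : (Matrix.diagonal dJ).det ≠ 0)
    (heven : Even (Module.finrank ℚ ↥(maximalRealSubfield L))) :
    IsEmpty (∀ v : HeightOneSpectrum (𝓞 ↥(maximalRealSubfield L)), (cmDatum L 2 (Matrix.diagonal dJ)).Local v ≃ₜ*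
      (cmDatum L 2 (Matrix.of fun i j : Fin 2 => if i.val + j.val + 1 = 2 then (1 : L) else 0)).Local v) := by
  have hH : ((Matrix.diagonal dJ).map (cmConjRingHom L))ᵀ = Matrix.diagonal dJ := by
    rw [map_cmConjRingHom_eq_map_complexConj]; exact hJh
  refine isEmpty_forall_cmDatum_local_equiv_antidiagTwo L (Matrix.diagonal dJ) hH hJdet hcδ hδ ?_
  -- `T` has odd cardinality, hence is non-empty
  by_contra hall
  push Not at hall
  have hempty : {v : HeightOneSpectrum (𝓞 ↥(maximalRealSubfield L)) |
      ¬ Liu2021.LemD1.IsIsotropic (Liu2021.LemD1OfPlace.standingData L v (IsCMField.complexConj L) 2 (Matrix.diagonal dJ) hcδ hδ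
        le_rfl hJh hJdet)} = ∅ := Set.eq_empty_of_forall_notMem fun v hv => hv (hall v)
  have hpar := (Liu2021.RemD5.even_ncard_not_isIsotropic_iff L ι₁ dJ hdJ hdJ0 hsig hcδ hδ hJh hJdet).1
    (by rw [hempty, Set.ncard_empty]; exact ⟨0, rfl⟩)
  exact (Nat.not_even_iff_odd.2 hpar) heven

end CM

end UnitaryGroup

end Literature.NumberTheory.Automorphic

end
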